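import Literature.Topology.FourManifolds.MMSWRasmussenFacts
import Summits.SmoothPoincare4.SmoothPoincare4.Theorems.DottedCircleRasmussenDcrGapHelperFriendsCarrierExterior
import Summits.SmoothPoincare4.SmoothPoincare4.Theorems.DottedCircleRasmussenDcrGapStubFriendsH2Aux
import Summits.SmoothPoincare4.SmoothPoincare4.Theorems.DottedCircleRasmussenDcrGapStubFriendsH2Aux2
import Summits.SmoothPoincare4.SmoothPoincare4.Theorems.DottedCircleRasmussenDcrGapStubFriendsH2Aux3

/-!
# Aux file 5 of stub `stub_friendsH2` (line `mk_friends`, crux `DcrGap`): the carrier side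
(item stmt-SmoothPoincare4-16128, route route-SmoothPoincare4-DottedCircleRasmussen)

Local homology of the closed smooth `4`-manifold `X` of the friends lemma along
`C⁺ = i(D_k) ∪ f₀(𝔻²) ∪ {q}` — the complement of the exterior piece `j(E)` — where `i` is a germ
chart of the model handlebody `D_k` (smooth, injective, immersive on an open `U ⊇ D_k`), `f₀` a
smooth disc meeting `i(D_k)` exactly along the circle `i(K₀)`, and `q` a point.  The relative
Mayer–Vietoris count of Aux file 1 along `C⁺ = A ∪ B`, `A = i(D_k)`, `B = f₀(𝔻²)` (if `q ∈ A ∪ B`)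
resp. `B = f₀(𝔻²) ∪ {q}` (if not), gives

* `FriendsH2.carrierCount` — **`H₃(X | C⁺; ℚ)`, `H₂(X | C⁺; ℚ)` are finite-dimensional and
  `dim H₃(X | C⁺) - dim H₂(X | C⁺) = p₃ - 1 - p₂`, `p_q = dim_ℚ H_q(ℝ⁴ | D_k; ℚ)`**, GIVEN that
  these two local homology groups of `ℝ⁴` along `D_k` are finite-dimensional,

the inputs being transferred along the open embeddings `i|_U : U → X`, `U ⊆ ℝ⁴`, `σ : ℝ⁴ → S⁴`
(Aux files 2, 3): `H_q(X | A) ≅ H_q(ℝ⁴ | D_k)`, `H₂(X | iK₀) = 0`, `H₃(X | iK₀; ℚ) ≅ ℚ`,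
`H₄(X | A) → H₄(X | iK₀)` onto (as `H₄(S⁴) ≅ H₄(S⁴ | σK₀)`), `H_q(X | B) = 0` (`q = 2, 3`).  This is
the `k ≥ 1` counterpart of the tree's `BallUnionDiscLocalHomology.lean` in the rank-only form
(Manolescu–Piccirillo 2023, §3.2, proof of Lemma 3.3).  Everything is proved; no definitions, no named
facts, no `sorry`.

## References

* A. Hatcher, *Algebraic Topology*, CUP 2002, §2.2 p. 152, Prop. 2B.1, §3.3 p. 233. [HatcherAT2002]
* C. Manolescu, L. Piccirillo, J. Lond. Math. Soc. 108 (2023), §3.2. [ManolescuPiccirillo2023]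
-/

-- the prescribed namespace `Summit.<P>.<Sub>.…` duplicates `SmoothPoincare4` (P = Sub)
set_option linter.dupNamespace false
set_option linter.style.longLine false

noncomputable section

open scoped Manifold ContDiff
open CategoryTheory Limits Set Function Metric Topology
open Literature.AlgebraicTopology.SingularHomology Literature.Topology.FourManifolds
open Literature.Topology.FourManifolds.MMSW

universe u

namespace Summit.SmoothPoincare4.SmoothPoincare4.Theorems.DcrGap.MkFriends

namespace FriendsH2

/-- Local notation: the `4`-sphere `S⁴ ⊂ ℝ⁵`. -/
local notation "𝕊⁴" => (Metric.sphere (0 : EuclideanSpace ℝ (Fin 5)) 1)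

/-- Transport of surjectivity of restriction maps along equalities of both sets. [folklore] -/
theorem surjective_restrictLocal_congr₂ {Y : Type u} [TopologicalSpace Y] {R : Type} [CommRing R]
    {M : Type} [AddCommGroup M] [Module R M] {K K' L L' : Set Y} (hK : K = K') (hL : L = L')
    (h : L ⊆ K) (h' : L' ⊆ K') (q : ℕ) :
    Surjective (restrictLocal R M h q) ↔ Surjective (restrictLocal R M h' q) := by
  subst hK hL
  rfl

/-- **`i(D_k) ∩ f₀(𝔻²) = i(K₀)`**: the handlebody and the core disc of the carrier meet exactly
along the knot (the open disc misses `i(D_k)`, the boundary circle is `i ∘ K₀`, `K₀ ⊂ ∂D_k`).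
[cite: ManolescuPiccirillo2023, §3.2] -/
theorem image_modelHandlebody_inter_image_disc_eq {k : ℕ} {X : Type u}
    {K₀ : (Metric.sphere (0 : EuclideanSpace ℝ (Fin 2)) 1) → EuclideanSpace ℝ (Fin 4)}
    (hK₀ : IsModelKnot k K₀) {i : EuclideanSpace ℝ (Fin 4) → X} {f₀ : EuclideanSpace ℝ (Fin 2) → X}
    (hf₀out : ∀ x : EuclideanSpace ℝ (Fin 2), ‖x‖ < 1 → f₀ x ∉ i '' modelHandlebody k)
    (hf₀K : ∀ t : (Metric.sphere (0 : EuclideanSpace ℝ (Fin 2)) 1), f₀ t = i (K₀ t)) :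
    i '' modelHandlebody k ∩ f₀ '' Metric.closedBall (0 : EuclideanSpace ℝ (Fin 2)) 1 =
      i '' range K₀ := by
  ext y
  constructor
  · rintro ⟨hyA, x, hx, rfl⟩
    have hx1 : ‖x‖ = 1 := by
      rcases (mem_closedBall_zero_iff.1 hx).lt_or_eq with h1 | h1
      · exact absurd hyA (hf₀out x h1)
      · exact h1
    exact ⟨K₀ ⟨x, mem_sphere_zero_iff_norm.2 hx1⟩, mem_range_self _,
      (hf₀K ⟨x, mem_sphere_zero_iff_norm.2 hx1⟩).symm⟩
  · rintro ⟨_, ⟨t, rfl⟩, rfl⟩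
    exact ⟨⟨K₀ t, modelBoundary_subset_modelHandlebody (hK₀.mem t), rfl⟩,
      ⟨(t : EuclideanSpace ℝ (Fin 2)), Metric.sphere_subset_closedBall t.2, hf₀K t⟩⟩

/-- **The carrier side counted.**  In a closed smooth `4`-manifold `X`, let `i` be a germ chart of
`D_k` on an open `U ⊇ D_k`, `f₀` a smooth disc whose open part misses `i(D_k)` and whose boundary
circle is `i ∘ K₀` (`K₀` a model knot), `q` a point, `C⁺ = i(D_k) ∪ f₀(𝔻²) ∪ {q}`.  If
`H₂(ℝ⁴ | D_k; ℚ)`, `H₃(ℝ⁴ | D_k; ℚ)` are finite-dimensional then so are `H₃(X | C⁺; ℚ)`,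
`H₂(X | C⁺; ℚ)`, and `dim H₃(X | C⁺) - dim H₂(X | C⁺) = dim H₃(ℝ⁴ | D_k) - 1 - dim H₂(ℝ⁴ | D_k)`
(relative Mayer–Vietoris, Manolescu–Piccirillo 2023, §3.2; the `k ≥ 1` counterpart of the tree's
`BallUnionDiscLocalHomology.lean`). [cite: ManolescuPiccirillo2023, §3.2, proof of Lemma 3.3]
[cite: HatcherAT2002, §2.2 p. 152 and §3.3 p. 233] -/
theorem carrierCount {k : ℕ}
    {K₀ : (Metric.sphere (0 : EuclideanSpace ℝ (Fin 2)) 1) → EuclideanSpace ℝ (Fin 4)}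
    (hK₀ : IsModelKnot k K₀)
    {X : Type} [TopologicalSpace X] [T2Space X] [ChartedSpace (EuclideanSpace ℝ (Fin 4)) X]
    [IsManifold (𝓡 4) ∞ X] [CompactSpace X]
    {U : Set (EuclideanSpace ℝ (Fin 4))} {i : EuclideanSpace ℝ (Fin 4) → X}
    {f₀ : EuclideanSpace ℝ (Fin 2) → X} (q : X)
    (hU : IsOpen U) (hDU : modelHandlebody k ⊆ U) (hi : ContMDiffOn (𝓡 4) (𝓡 4) ∞ i U)
    (hinj : InjOn i U) (hd : ∀ x ∈ U, Injective (mfderiv (𝓡 4) (𝓡 4) i x))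
    (hf₀ : ContMDiff (𝓡 2) (𝓡 4) ∞ f₀)
    (hf₀inj : InjOn f₀ (Metric.closedBall (0 : EuclideanSpace ℝ (Fin 2)) 1))
    (hf₀d : ∀ x ∈ Metric.closedBall (0 : EuclideanSpace ℝ (Fin 2)) 1, Injective (mfderiv (𝓡 2) (𝓡 4) f₀ x))
    (hf₀out : ∀ x : EuclideanSpace ℝ (Fin 2), ‖x‖ < 1 → f₀ x ∉ i '' modelHandlebody k)
    (hf₀K : ∀ t : (Metric.sphere (0 : EuclideanSpace ℝ (Fin 2)) 1), f₀ t = i (K₀ t))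
    [Module.Finite ℚ (localHomologyOfSet ℚ ℚ (EuclideanSpace ℝ (Fin 4)) (modelHandlebody k) 2)]
    [Module.Finite ℚ (localHomologyOfSet ℚ ℚ (EuclideanSpace ℝ (Fin 4)) (modelHandlebody k) 3)] :
    Module.Finite ℚ (localHomologyOfSet ℚ ℚ X
        (i '' modelHandlebody k ∪ f₀ '' Metric.closedBall (0 : EuclideanSpace ℝ (Fin 2)) 1 ∪ {q}) 3) ∧
      Module.Finite ℚ (localHomologyOfSet ℚ ℚ X
        (i '' modelHandlebody k ∪ f₀ '' Metric.closedBall (0 : EuclideanSpace ℝ (Fin 2)) 1 ∪ {q}) 2) ∧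
      (Module.finrank ℚ (localHomologyOfSet ℚ ℚ X
          (i '' modelHandlebody k ∪ f₀ '' Metric.closedBall (0 : EuclideanSpace ℝ (Fin 2)) 1 ∪ {q}) 3) : ℤ) -
        Module.finrank ℚ (localHomologyOfSet ℚ ℚ X
          (i '' modelHandlebody k ∪ f₀ '' Metric.closedBall (0 : EuclideanSpace ℝ (Fin 2)) 1 ∪ {q}) 2) =
      Module.finrank ℚ (localHomologyOfSet ℚ ℚ (EuclideanSpace ℝ (Fin 4)) (modelHandlebody k) 3) - 1 -
        Module.finrank ℚ (localHomologyOfSet ℚ ℚ (EuclideanSpace ℝ (Fin 4)) (modelHandlebody k) 2) := by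
  obtain ⟨N, σ, hσ, -⟩ := exists_isOpenEmbedding_range_eq_compl_singleton
  -- notation
  set Dk : Set (EuclideanSpace ℝ (Fin 4)) := modelHandlebody k with hDk
  set D : Set X := f₀ '' Metric.closedBall (0 : EuclideanSpace ℝ (Fin 2)) 1 with hD
  set A : Set X := i '' Dk with hA
  set Γ : Set X := i '' range K₀ with hΓ
  have hΓ₀D : range K₀ ⊆ Dk := by
    rintro _ ⟨t, rfl⟩
    exact modelBoundary_subset_modelHandlebody (hK₀.mem t)
  have hΓA : Γ ⊆ A := image_mono hΓ₀D
  -- the open embeddings `κ = i|U : U → X`, `val : U → ℝ⁴`, `σ ∘ val : U → S⁴`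
  have hκ : IsOpenEmbedding (U.restrict i) := isOpenEmbedding_restrict_of_germChart hU hi hinj hd
  have hval : IsOpenEmbedding (Subtype.val : U → EuclideanSpace ℝ (Fin 4)) := hU.isOpenEmbedding_subtypeVal
  have hκ₂ : IsOpenEmbedding (σ ∘ (Subtype.val : U → EuclideanSpace ℝ (Fin 4))) := hσ.comp hval
  set KD : Set U := Subtype.val ⁻¹' Dk with hKD
  set KΓ : Set U := Subtype.val ⁻¹' range K₀ with hKΓ
  have hKΓD : KΓ ⊆ KD := preimage_mono hΓ₀D
  have hvD : Subtype.val '' KD = Dk := by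
    rw [hKD, Subtype.image_preimage_coe, inter_eq_right.2 hDU]
  have hvΓ : Subtype.val '' KΓ = range K₀ := by
    rw [hKΓ, Subtype.image_preimage_coe, inter_eq_right.2 (hΓ₀D.trans hDU)]
  have hκD : U.restrict i '' KD = A := by
    rw [show U.restrict i = i ∘ Subtype.val from rfl, image_comp, hvD]
  have hκΓ : U.restrict i '' KΓ = Γ := by
    rw [show U.restrict i = i ∘ Subtype.val from rfl, image_comp, hvΓ]
  have hκ₂D : (σ ∘ Subtype.val) '' KD = σ '' Dk := by rw [image_comp, hvD]
  have hκ₂Γ : (σ ∘ Subtype.val) '' KΓ = range (σ ∘ K₀) := by rw [image_comp, hvΓ, range_comp]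
  -- compactness / closedness
  have hDkc : IsCompact Dk := isCompact_modelHandlebody k
  have hΓ₀c : IsCompact (range K₀) := isCompact_range hK₀.continuous
  have hic : ContinuousOn i U := hi.continuousOn
  have hAc' : IsCompact A := hDkc.image_of_continuousOn (hic.mono hDU)
  have hAc : IsClosed A := hAc'.isClosed
  have hΓc : IsClosed Γ := (hΓ₀c.image_of_continuousOn (hic.mono (hΓ₀D.trans hDU))).isClosed
  have hDc : IsClosed D := ((isCompact_closedBall _ _).image hf₀.continuous).isClosed
  have hσDc : IsClosed (σ '' Dk) := (hDkc.image hσ.continuous).isClosed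
  have hγc : Continuous (σ ∘ K₀) := hσ.continuous.comp hK₀.continuous
  have hγ : IsEmbedding (σ ∘ K₀) := (hγc.isClosedEmbedding (hσ.injective.comp hK₀.2.1)).isEmbedding
  have hσΓc : IsClosed (range (σ ∘ K₀)) := (isCompact_range hγc).isClosed
  -- transfer `H_q(X | A) ≅ H_q(ℝ⁴ | D_k)`
  have hTA : ∀ n : ℕ, Nonempty (localHomologyOfSet ℚ ℚ X A n ≃ₗ[ℚ]
      localHomologyOfSet ℚ ℚ (EuclideanSpace ℝ (Fin 4)) Dk n) := fun n => by
    have h := nonempty_linearEquiv_of_isOpenEmbedding₂ ℚ ℚ hκ hval (K := KD) (by rw [hκD]; exact hAc)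
      (by rw [hvD]; exact hDkc.isClosed) n
    rwa [hκD, hvD] at h
  obtain ⟨TA2⟩ := hTA 2
  obtain ⟨TA3⟩ := hTA 3
  haveI : Module.Finite ℚ (localHomologyOfSet ℚ ℚ X A 2) := Module.Finite.equiv TA2.symm
  haveI : Module.Finite ℚ (localHomologyOfSet ℚ ℚ X A 3) := Module.Finite.equiv TA3.symm
  -- transfer `H_q(X | Γ) ≅ H_q(S⁴ | σK₀)`
  have hTΓ : ∀ n : ℕ, Nonempty (localHomologyOfSet ℚ ℚ X Γ n ≃ₗ[ℚ]
      localHomologyOfSet ℚ ℚ 𝕊⁴ (range (σ ∘ K₀)) n) := fun n => by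
    have h := nonempty_linearEquiv_of_isOpenEmbedding₂ ℚ ℚ hκ hκ₂ (K := KΓ) (by rw [hκΓ]; exact hΓc)
      (by rw [hκ₂Γ]; exact hσΓc) n
    rwa [hκΓ, hκ₂Γ] at h
  obtain ⟨TΓ2⟩ := hTΓ 2
  obtain ⟨TΓ3⟩ := hTΓ 3
  have hΓ2 : IsZero (localHomologyOfSet ℚ ℚ X Γ 2) :=
    (isZero_iff_of_linearEquiv ℚ TΓ2).2 (isZero_localHomologyOfSet_circle_two ℚ ℚ (σ ∘ K₀) hγ)
  obtain ⟨hΓfin, hΓ3'⟩ := finite_and_finrank_localHomologyOfSet_circle_three (σ ∘ K₀) hγ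
  haveI := hΓfin
  haveI : Module.Finite ℚ (localHomologyOfSet ℚ ℚ X Γ 3) := Module.Finite.equiv TΓ3.symm
  have hΓ3 : Module.finrank ℚ (localHomologyOfSet ℚ ℚ X Γ 3) = 1 := by rw [TΓ3.finrank_eq, hΓ3']
  -- `H₄(X | A) → H₄(X | Γ)` is onto
  have h4 : Surjective (restrictLocal ℚ ℚ hΓA 4) := by
    have h := (surjective_restrictLocal_iff_of_isOpenEmbedding₂ ℚ ℚ hκ hκ₂ hKΓD
      (by rw [hκD]; exact hAc) (by rw [hκΓ]; exact hΓc) (by rw [hκ₂D]; exact hσDc)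
      (by rw [hκ₂Γ]; exact hσΓc) 4).2
      ((surjective_restrictLocal_congr₂ rfl hκ₂Γ.symm
        (hκ₂Γ ▸ image_mono hKΓD : range (σ ∘ K₀) ⊆ (σ ∘ Subtype.val) '' KD) (image_mono hKΓD) 4).1
        (surjective_restrictLocal_circle_four ℚ ℚ (σ ∘ K₀) hγ _))
    exact (surjective_restrictLocal_congr₂ hκD hκΓ (image_mono hKΓD) hΓA 4).1 h
  -- `A ∩ D = Γ` and the vanishing along the disc
  have hAD : A ∩ D = Γ := image_modelHandlebody_inter_image_disc_eq hK₀ hf₀out hf₀K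
  have hD0 : ∀ n : ℕ, 2 ≤ n → n ≤ 3 → IsZero (localHomologyOfSet ℚ ℚ X D n) := fun n hn2 hn3 =>
    isZero_localHomologyOfSet_smoothDisc hf₀ hf₀inj hf₀d ℚ ℚ hn2 hn3
  -- the two cases `q ∈ A ∪ D`, `q ∉ A ∪ D`
  by_cases hq : q ∈ A ∪ D
  · have hC : A ∪ D ∪ {q} = A ∪ D := union_eq_self_of_subset_right (singleton_subset_iff.2 hq)
    rw [hC]
    obtain ⟨h3, h2, hcount⟩ := mvCount hAc hDc hAD hΓA (hD0 2 le_rfl (by omega))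
      (hD0 3 (by omega) le_rfl) hΓ2 hΓ3 h4
    refine ⟨h3, h2, ?_⟩
    rw [← TA2.finrank_eq, ← TA3.finrank_eq]
    exact hcount
  · have hqA : q ∉ A := fun h => hq (Or.inl h)
    have hqD : q ∉ D := fun h => hq (Or.inr h)
    have hC : A ∪ D ∪ {q} = A ∪ (D ∪ {q}) := union_assoc _ _ _
    have hAB : A ∩ (D ∪ {q}) = Γ := by
      rw [inter_union_distrib_left, hAD, Set.inter_singleton_eq_empty.2 hqA, union_empty]
    rw [hC]
    obtain ⟨h3, h2, hcount⟩ := mvCount hAc (hDc.union isClosed_singleton) hAB hΓA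
      (isZero_localHomologyOfSet_union_singleton ℚ ℚ hDc hqD (by omega) (hD0 2 le_rfl (by omega)))
      (isZero_localHomologyOfSet_union_singleton ℚ ℚ hDc hqD (by omega) (hD0 3 (by omega) le_rfl))
      hΓ2 hΓ3 h4
    refine ⟨h3, h2, ?_⟩
    rw [← TA2.finrank_eq, ← TA3.finrank_eq]
    exact hcount

end FriendsH2

/-- **Registered helper (aux 5 of `stub_friendsH2`)**: the carrier side — `dim H₃(X | C⁺) - dim H₂(X | C⁺) = dim H₃(ℝ⁴ | D_k) - 1 - dim H₂(ℝ⁴ | D_k)` for `C⁺ = i(D_k) ∪ f₀(𝔻²) ∪ {q}`, given finite-dimensionality of the latter (`FriendsH2.carrierCount`; Manolescu–Piccirillo 2023, §3.2). [cite: ManolescuPiccirillo2023, §3.2, proof of Lemma 3.3] -/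
theorem helper_friendsH2_carrierCount : ∀ (k : ℕ) (K₀ : (Metric.sphere (0 : EuclideanSpace ℝ (Fin 2)) 1) → EuclideanSpace ℝ (Fin 4)), Literature.Topology.FourManifolds.MMSW.IsModelKnot k K₀ → ∀ (X : Type) [TopologicalSpace X] [T2Space X] [ChartedSpace (EuclideanSpace ℝ (Fin 4)) X] [IsManifold (𝓡 4) ((⊤ : ℕ∞) : WithTop ℕ∞) X] [CompactSpace X] (U : Set (EuclideanSpace ℝ (Fin 4))) (i : EuclideanSpace ℝ (Fin 4) → X) (f₀ : EuclideanSpace ℝ (Fin 2) → X) (q : X), IsOpen U → Literature.Topology.FourManifolds.MMSW.modelHandlebody k ⊆ U → ContMDiffOn (𝓡 4) (𝓡 4) ((⊤ : ℕ∞) : WithTop ℕ∞) i U → Set.InjOn i U → (∀ x ∈ U, Function.Injective (mfderiv (𝓡 4) (𝓡 4) i x)) → ContMDiff (𝓡 2) (𝓡 4) ((⊤ : ℕ∞) : WithTop ℕ∞) f₀ → Set.InjOn f₀ (Metric.closedBall (0 : EuclideanSpace ℝ (Fin 2)) 1) → (∀ x ∈ Metric.closedBall (0 : EuclideanSpace ℝ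 (Fin 2)) 1, Function.Injective (mfderiv (𝓡 2) (𝓡 4) f₀ x)) → (∀ x : EuclideanSpace ℝ (Fin 2), ‖x‖ < 1 → f₀ x ∉ i '' Literature.Topology.FourManifolds.MMSW.modelHandlebody k) → (∀ t : (Metric.sphere (0 : EuclideanSpace ℝ (Fin 2)) 1), f₀ t = i (K₀ t)) → Module.Finite ℚ (Literature.AlgebraicTopology.SingularHomology.localHomologyOfSet ℚ ℚ (EuclideanSpace ℝ (Fin 4)) (Literature.Topology.FourManifolds.MMSW.modelHandlebody k) 2) → Module.Finite ℚ (Literature.AlgebraicTopology.SingularHomology.localHomologyOfSet ℚ ℚ (EuclideanSpace ℝ (Fin 4)) (Literature.Topology.FourManifolds.MMSW.modelHandlebody k) 3) → Module.Finite ℚ (Literature.AlgebraicTopology.SingularHomology.localHomologyOfSet ℚ ℚ X (i '' Literature.Topology.FourManifolds.MMSW.modelHandlebody k ∪ f₀ '' Metric.closedBall (0 : EuclideanSpace ℝ (Fin 2)) 1 ∪ {q}) 3) ∧ Module.Finite ℚ (Literature.AlgebraicTopology.SingularHomology.localHomologyOfSet ℚ ℚ X (i '' Literature.Topology.FourManifolds.MMSW.modelHandlebody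 k ∪ f₀ '' Metric.closedBall (0 : EuclideanSpace ℝ (Fin 2)) 1 ∪ {q}) 2) ∧ (Module.finrank ℚ (Literature.AlgebraicTopology.SingularHomology.localHomologyOfSet ℚ ℚ X (i '' Literature.Topology.FourManifolds.MMSW.modelHandlebody k ∪ f₀ '' Metric.closedBall (0 : EuclideanSpace ℝ (Fin 2)) 1 ∪ {q}) 3) : ℤ) - Module.finrank ℚ (Literature.AlgebraicTopology.SingularHomology.localHomologyOfSet ℚ ℚ X (i '' Literature.Topology.FourManifolds.MMSW.modelHandlebody k ∪ f₀ '' Metric.closedBall (0 : EuclideanSpace ℝ (Fin 2)) 1 ∪ {q}) 2) = Module.finrank ℚ (Literature.AlgebraicTopology.SingularHomology.localHomologyOfSet ℚ ℚ (EuclideanSpace ℝ (Fin 4)) (Literature.Topology.FourManifolds.MMSW.modelHandlebody k) 3) - 1 - Module.finrank ℚ (Literature.AlgebraicTopology.SingularHomology.localHomologyOfSet ℚ ℚ (EuclideanSpace ℝ (Fin 4)) (Literature.Topology.FourManifolds.MMSW.modelHandlebody k) 2) := by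
  intro k K₀ hK₀ X _ _ _ _ _ U i f₀ q hU hDU hi hinj hd hf₀ hf₀inj hf₀d hf₀out hf₀K i₁ i₂
  haveI := i₁; haveI := i₂
  exact FriendsH2.carrierCount hK₀ q hU hDU hi hinj hd hf₀ hf₀inj hf₀d hf₀out hf₀K

end Summit.SmoothPoincare4.SmoothPoincare4.Theorems.DcrGap.MkFriends

end
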